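import Literature.NumberTheory.EllipticCurves.BSDQuadraticDescentShaOddPartProofs
import HarnessLib

/-!
# The odd part of `Ш` under quadratic base change, in ANY rank:
# `#Ш(E_K/K)[p^∞] = #Ш(E/ℚ)[p^∞] · #Ш(E^{(d_K)}/ℚ)[p^∞]` for odd `p`

Sibling *proofs* file (theorems only, no definitions, no named facts) of
`Literature.NumberTheory.EllipticCurves.BSDQuadraticDescentShaOddPartProofs`. That file proves the
displayed identity in the **rank-zero shape** (`E(K)` finite, where `Sel_{p^∞} = Ш[p^∞]`,
`WeierstrassCurve.card_primaryComponent_sha_baseChange_quadratic_of_odd`). Here the finiteness of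
`E(K)` is removed: for an elliptic curve `E/ℚ`, a quadratic field `K`, a `ℚ`-model `Wd` of the twist
`E^{(d_K)}`, a `K`-model `W'` of `E_K`, and an odd prime `p` such that `Ш(E/ℚ)[p^∞]` and
`Ш(E^{(d_K)}/ℚ)[p^∞]` are finite,

`#Ш(W'/K)[p^∞] = #Ш(E/ℚ)[p^∞] · #Ш(E^{(d_K)}/ℚ)[p^∞]`

(`WeierstrassCurve.card_primaryComponent_sha_baseChange_quadratic_of_odd_of_finite`). This is the
statement "`Ш(E/K)[p^∞] ≅ Ш(E/ℚ)[p^∞] ⊕ Ш(E^{D}/ℚ)[p^∞]`" (orders) used for analytic rank ONE over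
`K` by Jetchev–Skinner–Wan, Camb. J. Math. 5 (2017), §7.4.1 (arXiv:1512.06894 p. 30, l. 92: "As
`Ш(E/K')[p^∞] ≅ Ш(E/ℚ)[p^∞] ⊕ Ш(E^{D'}/ℚ)[p^∞]` …") and §7.4.2, and by Gross 1991 / Kolyvagin; the
rank-zero file could not serve there.

## Proof

For a curve `X` over a number field `F` write `S_X = Sel_{p^∞}(X/F) ⊆ H¹(F, X[p^∞])`,
`π_X : H¹(F, X[p^∞]) → H¹(F, X)` and `R_X = ker π_X ⊆ S_X` (`= E(F) ⊗ ℚ_p/ℤ_p`, the image of the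
Kummer map, `range_kummerMapPInfty`). The fundamental sequence
`0 → R_X → S_X → Ш(X/F)[p^∞] → 0` (`map_primaryH1ToH1_selmerGroupPInfty`) gives
**`#Ш(X/F)[p^∞] = [S_X : R_X]`** in every rank (`card_primaryComponent_sha_eq_relIndex`;
`AddSubgroup.relIndex_ker`). For `K = ℚ(θ)`, `θ² = c`, the comparison map
`Φ : S_E × S_{E^{(c)}} → S_{E_K}`, `(η, η') ↦ res η + ψ_*(res η')` is bijective for odd `p`
(`comparisonMap_bijective_of_odd`, Dokchitser–Dokchitser 2010, proof of Lemma 4.14), and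
**`Φ(R_E × R_{E^{(c)}}) = R_{E_K}`**: "`⊆`" because restriction and the twist isomorphism over `K`
commute with `H¹(·, E[p^∞]) → H¹(·, E)` (`primaryH1ToH1_resPrimary`,
`mem_ker_primaryH1ToH1_iff_h1PrimaryIso_mem`); "`⊇`" because `R_{E_K}` is `p`-divisible
(`tensorPrufer_divisible`) while `Ш(E/ℚ)[p^∞]`, `Ш(E^{(c)}/ℚ)[p^∞]` are finite, so a class of
`Φ⁻¹(R_{E_K})`, being `p^k`-divisible inside `S_E × S_{E^{(c)}}` for every `k`, maps to `0` in both
`Ш[p^∞]`'s. Hence `[S_{E_K} : R_{E_K}] = [S_E : R_E] · [S_{E^{(c)}} : R_{E^{(c)}}]`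
(`AddSubgroup.index_map_of_bijective`, `AddSubgroup.index_prod`). Finally `Ш[p^∞]` is a model
invariant (`shaEquiv` is additive; `card_primaryComponent_sha_variableChange`) and
`E^{(d_K)} ≅ E^{(c)}` over `ℚ` (`d_K = c q²`).

## References

* D. Jetchev, C. Skinner, X. Wan, *The Birch and Swinnerton-Dyer formula for elliptic curves of
  analytic rank one*, Camb. J. Math. 5 (2017) 369–434 = arXiv:1512.06894, §7.4.1 (p. 30).
  [JetchevSkinnerWan2017]
* T. Dokchitser, V. Dokchitser, *On the Birch–Swinnerton-Dyer quotients modulo squares*, Ann. of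
  Math. 172 (2010), Lemma 4.14 (proof). [DokchitserDokchitserAnnals2010]
* R. Greenberg, *Iwasawa theory for elliptic curves*, LNM 1716 (1999), §2, pp. 62–63 (the
  fundamental sequence). [Greenberg1999]
* J. H. Silverman, *The Arithmetic of Elliptic Curves*, 2nd ed., GTM 106 (2009), X.§4 (`Ш` and the
  Selmer groups are attached to `E/K`). [SilvermanAEC2009]

## Design notes

Theorems only (kernel-reviewed sibling); explicit finiteness hypotheses on the two `ℚ`-side
`Ш[p^∞]`'s as instances `[Finite (primaryComponent ·.sha p)]` (in the applications they come from
Gross–Zagier–Kolyvagin); `K : Type` (universe `0`) as in `comparisonMap`. Written for the cell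
`b2b-bsdres` (class X10, rank-one Kolyvagin–Jetchev lever), 2026-08-18.
-/

noncomputable section

open scoped Classical TensorProduct

universe u

namespace WeierstrassCurve

open Literature.NumberTheory.EllipticCurves Literature.NumberTheory.QuadraticFields

/-! ## `#Ш(X/F)[p^∞] = [Sel_{p^∞}(X/F) : E(F) ⊗ ℚ_p/ℤ_p]` in every rank -/

section IndexFormula

variable {F : Type u} [Field F] [NumberField F] (X : WeierstrassCurve F) [X.IsElliptic]
  (p : ℕ) [Fact p.Prime]

/-- **`#Ш(E/F)[p^∞] = [Sel_{p^∞}(E/F) : ker (H¹(F, E[p^∞]) → H¹(F, E))]`** for an elliptic curve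
over a number field and any prime `p`, in every rank: the image of `Sel_{p^∞}(E/F)` under
`H¹(F, E[p^∞]) → H¹(F, E)` is `Ш(E/F)[p^∞]` (`map_primaryH1ToH1_selmerGroupPInfty`), so the
relative index of the kernel in the Selmer group is `#Ш(E/F)[p^∞]` (`AddSubgroup.relIndex_ker`;
`Nat.card`, hence `0 = 0` in the infinite case). Greenberg (1999), §2, p. 63
(`Ш_E(M)_p = Sel_E(M)_p / Im κ`). [cite: Greenberg1999, §2, pp. 62–63] -/
theorem card_primaryComponent_sha_eq_relIndex :
    Nat.card (AddCommGroup.primaryComponent X.sha p) =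
      (X.primaryH1ToH1 p).ker.relIndex (selmerGroupPInfty X p) := by
  rw [AddSubgroup.relIndex_ker,
    X.map_primaryH1ToH1_selmerGroupPInfty p X.zsmul_geomPoints_surjective_holds]
  exact Nat.card_congr ((AddCommGroup.primaryComponent X.sha p).equivMapOfInjective X.sha.subtype
    fun _ _ h ↦ Subtype.ext h).toEquiv

/-- The kernel `ker (H¹(F, E[p^∞]) → H¹(F, E)) = E(F) ⊗ ℚ_p/ℤ_p` is `p^k`-divisible INSIDE itself
for every `k` (`range_kummerMapPInfty` and the `p`-divisibility of `E(F) ⊗ ℚ_p/ℤ_p`,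
`tensorPrufer_divisible`). Greenberg (1999), §2, p. 62. [cite: Greenberg1999, §2, pp. 62–63] -/
theorem exists_pow_nsmul_eq_of_mem_ker_primaryH1ToH1 (k : ℕ) {z : galH1Primary X p}
    (hz : z ∈ (X.primaryH1ToH1 p).ker) :
    ∃ z' ∈ (X.primaryH1ToH1 p).ker, p ^ k • z' = z := by
  have hdiv : X.zsmul_geomPoints_surjective := X.zsmul_geomPoints_surjective_holds
  rw [← X.range_kummerMapPInfty p hdiv] at hz ⊢
  obtain ⟨t, rfl⟩ := hz
  -- `t = p ^ k • t'` in `E(F) ⊗ ℚ_p/ℤ_p`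
  have hpow : ∀ (j : ℕ) (x : X.toAffine.Point ⊗[ℤ] PruferQuot p),
      ∃ y : X.toAffine.Point ⊗[ℤ] PruferQuot p, p ^ j • y = x := by
    intro j
    induction j with
    | zero => exact fun x ↦ ⟨x, by rw [pow_zero, one_smul]⟩
    | succ j ih =>
      intro x
      obtain ⟨y, rfl⟩ := tensorPrufer_divisible p _ x
      obtain ⟨y', rfl⟩ := ih y
      exact ⟨y', by rw [pow_succ, mul_comm, mul_smul]⟩
  obtain ⟨t', rfl⟩ := hpow k t
  exact ⟨X.kummerMapPInfty p hdiv t', ⟨t', rfl⟩, by rw [map_nsmul]⟩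

end IndexFormula

/-! ## A uniform exponent for a finite `p`-primary component -/

/-- A finite `p`-primary component is killed by one power of `p` (take the maximum of the
exponents over the finite group). [folklore] -/
theorem exists_pow_nsmul_primaryComponent_eq_zero (A : Type*) [AddCommGroup A] (p : ℕ)
    [Fact p.Prime] [Finite (AddCommGroup.primaryComponent A p)] :
    ∃ k : ℕ, ∀ g : AddCommGroup.primaryComponent A p, p ^ k • g = 0 := by
  haveI : Fintype (AddCommGroup.primaryComponent A p) := Fintype.ofFinite _
  have h : ∀ g : AddCommGroup.primaryComponent A p, ∃ k : ℕ, p ^ k • g = 0 := fun g ↦ by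
    obtain ⟨k, hk⟩ := (AddCommGroup.mem_primaryComponent (G := A) (p := p)).mp g.2
    exact ⟨k, Subtype.ext (by rw [AddSubmonoidClass.coe_nsmul, hk, ZeroMemClass.coe_zero])⟩
  choose f hf using h
  refine ⟨Finset.univ.sup f, fun g ↦ ?_⟩
  have hle : f g ≤ Finset.univ.sup f := Finset.le_sup (Finset.mem_univ g)
  obtain ⟨m, hm⟩ := Nat.exists_eq_add_of_le hle
  rw [hm, pow_add, mul_comm, mul_smul, hf g, smul_zero]

/-! ## `ker (H¹(·, E[p^∞]) → H¹(·, E))` under a change of variables -/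

section KerVariableChange

variable {L : Type u} [Field L] {W₁ W₂ : WeierstrassCurve L} {V : VariableChange L} (p : ℕ)

/-- **The kernels `ker (H¹(L, Eᵢ[p^∞]) → H¹(L, Eᵢ))` of isomorphic curves correspond** under
`h1PrimaryIso` (the intertwined-kernels lemma `mem_resKer_iff_h1Equiv_mem` for the square
`E₁[p^∞] ↪ E₁(L̄) ≃ E₂(L̄) ↩ E₂[p^∞]`, `twistPointsIso`/`primaryIso`). Silverman, *AEC*, X.§4.
[cite: SilvermanAEC2009, X.§4] -/
theorem mem_ker_primaryH1ToH1_iff_h1PrimaryIso_mem (hV : V • W₁ = W₂) (s : galH1Primary W₁ p) :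
    s ∈ (W₁.primaryH1ToH1 p).ker ↔ h1PrimaryIso p hV s ∈ (W₂.primaryH1ToH1 p).ker :=
  mem_resKer_iff_h1Equiv_mem (ContinuousMonoidHom.id _) (geomPrimaryTorsion W₁ p).subtype
    (fun _ _ ↦ rfl) (geomPrimaryTorsion W₂ p).subtype (fun _ _ ↦ rfl) (primaryIso p hV)
    (primaryIso_smul p hV) (twistPointsIso hV) (twistPointsIso_smul hV) (fun _ ↦ rfl) s

end KerVariableChange

/-! ## `Ш[p^∞]` under a change of variables -/

section ShaVariableChange

variable {L : Type u} [Field L] [NumberField L] (Y : WeierstrassCurve L) (C : VariableChange L)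
  (p : ℕ)

/-- **`#Ш(C • E/L)[p^∞] = #Ш(E/L)[p^∞]`**: the tree's `shaEquiv Y C : Ш(Y) ≃ Ш(C • Y)` is the
restriction of the additive `galH1Equiv`, hence additive, and additive isomorphisms identify
`p`-primary components (`primaryComponentCongr`). Silverman, *AEC*, X.§4 (`Ш` is attached to `E/L`,
not to an equation). [cite: SilvermanAEC2009, X.§4] -/
theorem card_primaryComponent_sha_variableChange :
    Nat.card (AddCommGroup.primaryComponent (C • Y).sha p) =
      Nat.card (AddCommGroup.primaryComponent Y.sha p) :=
  (Nat.card_congr (primaryComponentCongr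
    ({ shaEquiv Y C with
       map_add' := fun a b ↦
         Subtype.ext (map_add (galH1Equiv Y C) (a : Y.galH1) (b : Y.galH1)) } :
      Y.sha ≃+ (C • Y).sha) p).toEquiv).symm

/-- Finiteness of `Ш[p^∞]` passes along a change of variables (same mechanism).
[cite: SilvermanAEC2009, X.§4] -/
theorem finite_primaryComponent_sha_variableChange
    [Finite (AddCommGroup.primaryComponent Y.sha p)] :
    Finite (AddCommGroup.primaryComponent (C • Y).sha p) :=
  Finite.of_equiv _ (primaryComponentCongr
    ({ shaEquiv Y C with
       map_add' := fun a b ↦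
         Subtype.ext (map_add (galH1Equiv Y C) (a : Y.galH1) (b : Y.galH1)) } :
      Y.sha ≃+ (C • Y).sha) p).toEquiv

end ShaVariableChange

end WeierstrassCurve

/-! ## The comparison map carries `R_E × R_{E^{(c)}}` onto `R_{E_K}` -/

namespace Literature.NumberTheory.EllipticCurves

open WeierstrassCurve Literature.NumberTheory.QuadraticFields

section Comparison

variable (W : WeierstrassCurve ℚ) (K : Type) [Field K] [NumberField K] (h2 : Module.finrank ℚ K = 2)
  {θ : K} {c : ℚ} (hθ : θ ∉ Set.range (algebraMap ℚ K)) (hc : θ ^ 2 = algebraMap ℚ K c)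
  (p : ℕ)

/-- Unfolding the comparison map on underlying classes: `Φ(η, η') = res η + ψ_*(res η')`.
[cite: DokchitserDokchitserAnnals2010, Lemma 4.14 (proof)] -/
theorem coe_comparisonMap_apply (x : selmerGroupPInfty W p × selmerGroupPInfty (W.quadraticTwist c) p) :
    (comparisonMap W K hθ hc p x : galH1Primary (W.baseChange K) p) =
      resPrimary W K p (x.1 : galH1Primary W p) +
        hPsiK W K hθ hc p (resPrimary (W.quadraticTwist c) K p (x.2 : galH1Primary _ p)) :=
  rfl

/-- **The twist isomorphism over `K` respects `ker (H¹(K, ·[p^∞]) → H¹(K, ·))`**: `hPsiK` is a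
composite of two `h1PrimaryIso`'s (`mem_ker_primaryH1ToH1_iff_h1PrimaryIso_mem`).
[cite: SilvermanAEC2009, X.§4] -/
theorem mem_ker_primaryH1ToH1_iff_hPsiK_mem (s : galH1Primary ((W.quadraticTwist c).baseChange K) p) :
    s ∈ (((W.quadraticTwist c).baseChange K).primaryH1ToH1 p).ker ↔
      hPsiK W K hθ hc p s ∈ ((W.baseChange K).primaryH1ToH1 p).ker := by
  rw [hPsiK, AddEquiv.trans_apply,
    mem_ker_primaryH1ToH1_iff_h1PrimaryIso_mem p (twistUntwist_smul_baseChange W hθ hc) s,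
    mem_ker_primaryH1ToH1_iff_h1PrimaryIso_mem p
      (map_smul_baseChange_eq_quadraticTwist_one W (sqChange_spec W) (K := K)),
    AddEquiv.apply_symm_apply]

variable [Fact p.Prime]

include h2 in
/-- **`Φ(R_E × R_{E^{(c)}}) = R_{E_K}` for odd `p`**, where `R_X = ker (H¹(·, X[p^∞]) → H¹(·, X))`
viewed inside `Sel_{p^∞}(X)` and `Φ` is the comparison map: "`⊆`" by the compatibility of
restriction and of the twist isomorphism with `H¹(·, E[p^∞]) → H¹(·, E)`; "`⊇`" because `R_{E_K}`
is `p^k`-divisible for all `k` while `Ш(E/ℚ)[p^∞]`, `Ш(E^{(c)}/ℚ)[p^∞]` are finite (a `Φ`-preimage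
of a `p^k`-divisible class is `p^k`-divisible, and then dies in both `Ш[p^∞]`'s).
Jetchev–Skinner–Wan 2017, §7.4.1 ("`Ш(E/K)[p^∞] ≅ Ш(E/ℚ)[p^∞] ⊕ Ш(E^{D}/ℚ)[p^∞]`").
[cite: JetchevSkinnerWan2017, §7.4.1 (arXiv:1512.06894 p. 30)] [cite: DokchitserDokchitserAnnals2010, Lemma 4.14 (proof)] -/
theorem map_comparisonMap_prod_ker_eq (hp : p ≠ 2)
    [(W.quadraticTwist c).IsElliptic] [(W.baseChange K).IsElliptic]
    [Finite (AddCommGroup.primaryComponent W.sha p)]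
    [Finite (AddCommGroup.primaryComponent (W.quadraticTwist c).sha p)] :
    (((W.primaryH1ToH1 p).ker.addSubgroupOf (selmerGroupPInfty W p)).prod
        (((W.quadraticTwist c).primaryH1ToH1 p).ker.addSubgroupOf
          (selmerGroupPInfty (W.quadraticTwist c) p))).map (comparisonMap W K hθ hc p) =
      ((W.baseChange K).primaryH1ToH1 p).ker.addSubgroupOf (selmerGroupPInfty (W.baseChange K) p) := by
  have hodd : Odd p := (Fact.out : p.Prime).odd_of_ne_two hp
  have hbij := comparisonMap_bijective_of_odd W K h2 hθ hc p hodd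
  ext s
  constructor
  · -- `⊆`: compatibility of `res` and `ψ_*` with `H¹(·, E[p^∞]) → H¹(·, E)`
    intro hs
    obtain ⟨x, hx, rfl⟩ := AddSubgroup.mem_map.mp hs
    rw [AddSubgroup.mem_prod, AddSubgroup.mem_addSubgroupOf, AddSubgroup.mem_addSubgroupOf,
      AddMonoidHom.mem_ker, AddMonoidHom.mem_ker] at hx
    rw [AddSubgroup.mem_addSubgroupOf, AddMonoidHom.mem_ker, coe_comparisonMap_apply, map_add,
      primaryH1ToH1_resPrimary, hx.1, map_zero, zero_add, ← AddMonoidHom.mem_ker,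
      ← mem_ker_primaryH1ToH1_iff_hPsiK_mem, AddMonoidHom.mem_ker, primaryH1ToH1_resPrimary, hx.2,
      map_zero]
  · -- `⊇`: divisibility of `R_{E_K}` against the finiteness of the two `Ш[p^∞]`
    intro hs
    rw [AddSubgroup.mem_addSubgroupOf] at hs
    obtain ⟨k₁, hk₁⟩ := exists_pow_nsmul_primaryComponent_eq_zero W.sha p
    obtain ⟨k₂, hk₂⟩ := exists_pow_nsmul_primaryComponent_eq_zero (W.quadraticTwist c).sha p
    obtain ⟨z', hz', hz's⟩ :=
      (W.baseChange K).exists_pow_nsmul_eq_of_mem_ker_primaryH1ToH1 p (k₁ + k₂) hs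
    have hz'S : z' ∈ selmerGroupPInfty (W.baseChange K) p :=
      (W.baseChange K).ker_primaryH1ToH1_le_selmerGroupPInfty p hz'
    obtain ⟨u, hu⟩ := hbij.2 ⟨z', hz'S⟩
    refine AddSubgroup.mem_map.mpr ⟨p ^ (k₁ + k₂) • u, ?_, ?_⟩
    · -- both components of `p^(k₁+k₂) • u` die in `H¹(ℚ, ·)`
      rw [AddSubgroup.mem_prod, AddSubgroup.mem_addSubgroupOf, AddSubgroup.mem_addSubgroupOf,
        AddMonoidHom.mem_ker, AddMonoidHom.mem_ker, Prod.smul_fst, Prod.smul_snd,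
        AddSubmonoidClass.coe_nsmul, AddSubmonoidClass.coe_nsmul, map_nsmul, map_nsmul]
      constructor
      · -- `π_E(u.1) ∈ Ш(E/ℚ)[p^∞]`, killed by `p^k₁`
        have hsha : W.primaryH1ToH1 p (u.1 : galH1Primary W p) ∈ W.sha :=
          AddSubgroup.mem_comap.mp ((W.selmerGroupPInfty_eq_comap_sha p).le u.1.2)
        have hprim : (⟨_, hsha⟩ : W.sha) ∈ AddCommGroup.primaryComponent W.sha p := by
          obtain ⟨j, hj⟩ := exists_pow_nsmul_eq_zero_galH1Primary W p (u.1 : galH1Primary W p)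
          exact (AddCommGroup.mem_primaryComponent (G := W.sha) (p := p)).mpr
            ⟨j, Subtype.ext (by
              rw [AddSubmonoidClass.coe_nsmul, ZeroMemClass.coe_zero, ← map_nsmul, hj, map_zero])⟩
        have h0 := hk₁ ⟨_, hprim⟩
        have h0' : p ^ k₁ • W.primaryH1ToH1 p (u.1 : galH1Primary W p) = 0 := by
          have := congrArg (fun g : AddCommGroup.primaryComponent W.sha p ↦ ((g : W.sha) : W.galH1)) h0
          simpa only [AddSubmonoidClass.coe_nsmul, ZeroMemClass.coe_zero] using this
        rw [pow_add, mul_comm, mul_smul, h0', smul_zero]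
      · have hsha : (W.quadraticTwist c).primaryH1ToH1 p (u.2 : galH1Primary _ p) ∈
            (W.quadraticTwist c).sha :=
          AddSubgroup.mem_comap.mp (((W.quadraticTwist c).selmerGroupPInfty_eq_comap_sha p).le u.2.2)
        have hprim : (⟨_, hsha⟩ : (W.quadraticTwist c).sha) ∈
            AddCommGroup.primaryComponent (W.quadraticTwist c).sha p := by
          obtain ⟨j, hj⟩ :=
            exists_pow_nsmul_eq_zero_galH1Primary (W.quadraticTwist c) p (u.2 : galH1Primary _ p)
          exact (AddCommGroup.mem_primaryComponent (G := (W.quadraticTwist c).sha) (p := p)).mpr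
            ⟨j, Subtype.ext (by
              rw [AddSubmonoidClass.coe_nsmul, ZeroMemClass.coe_zero, ← map_nsmul, hj, map_zero])⟩
        have h0 := hk₂ ⟨_, hprim⟩
        have h0' : p ^ k₂ • (W.quadraticTwist c).primaryH1ToH1 p (u.2 : galH1Primary _ p) = 0 := by
          have := congrArg (fun g : AddCommGroup.primaryComponent (W.quadraticTwist c).sha p ↦
            ((g : (W.quadraticTwist c).sha) : (W.quadraticTwist c).galH1)) h0
          simpa only [AddSubmonoidClass.coe_nsmul, ZeroMemClass.coe_zero] using this
        rw [pow_add, mul_smul, h0', smul_zero]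
    · rw [map_nsmul, hu]
      exact Subtype.ext (by rw [AddSubmonoidClass.coe_nsmul, hz's])

end Comparison

end Literature.NumberTheory.EllipticCurves

/-! ## The odd part of `Ш` over `K`, any rank -/

namespace WeierstrassCurve

open Literature.NumberTheory.EllipticCurves Literature.NumberTheory.QuadraticFields

/-- **The odd part of `Ш` under quadratic base change, any rank** (the order form of
"`Ш(E/K)[p^∞] ≅ Ш(E/ℚ)[p^∞] ⊕ Ш(E^{D}/ℚ)[p^∞]` as `p` is odd", Jetchev–Skinner–Wan 2017 §7.4.1,
p. 30; odd-primary part of the `Ш`-term of Milne 1972 Thm. 1 / Dokchitser–Dokchitser 2010, proof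
of Thm. 8). Let `W/ℚ` be elliptic, `K` a quadratic field, `Wd` a `ℚ`-model of the twist
`W^{(d_K)}`, `W'` a `K`-model of `W_K`, and `p` an odd prime with `Ш(W/ℚ)[p^∞]` and `Ш(Wd/ℚ)[p^∞]`
finite. Then `#Ш(W'/K)[p^∞] = #Ш(W/ℚ)[p^∞] · #Ш(Wd/ℚ)[p^∞]` (in particular `Ш(W'/K)[p^∞]` is finite).
Proof: `K = ℚ(θ)`, `θ² = c`, `d_K = c q²`; `#Ш(X)[p^∞] = [S_X : R_X]` for the three curves
(`card_primaryComponent_sha_eq_relIndex`); the comparison isomorphism of odd `p`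
(`comparisonMap_bijective_of_odd`) carries `R_W × R_{W^{(c)}}` onto `R_{W_K}`
(`map_comparisonMap_prod_ker_eq`), so the indices multiply (`AddSubgroup.index_map_of_bijective`,
`AddSubgroup.index_prod`); `Ш[p^∞]` is a model invariant (`card_primaryComponent_sha_variableChange`).
[cite: JetchevSkinnerWan2017, §7.4.1 (arXiv:1512.06894 p. 30)] [cite: DokchitserDokchitserAnnals2010, Lemma 4.14 (proof) and §2.1 (proof of Thm. 8)] -/
theorem card_primaryComponent_sha_baseChange_quadratic_of_odd_of_finite (W : WeierstrassCurve ℚ)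
    [W.IsElliptic] (K : Type) [Field K] [NumberField K] (h2 : Module.finrank ℚ K = 2)
    (Wd : WeierstrassCurve ℚ) [Wd.IsElliptic]
    (hWd : ∃ C : VariableChange ℚ, C • W.quadraticTwist (NumberField.discr K : ℚ) = Wd)
    (W' : WeierstrassCurve K) [W'.IsElliptic] (hW' : ∃ C : VariableChange K, C • W.baseChange K = W')
    (p : ℕ) [Fact p.Prime] (hp : p ≠ 2)
    [Finite (AddCommGroup.primaryComponent W.sha p)]
    [Finite (AddCommGroup.primaryComponent Wd.sha p)] :
    Nat.card (AddCommGroup.primaryComponent W'.sha p) =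
      Nat.card (AddCommGroup.primaryComponent W.sha p) *
        Nat.card (AddCommGroup.primaryComponent Wd.sha p) := by
  obtain ⟨θ, c, hθ, hc⟩ := Quadratic.exists_sq_eq_algebraMap (F := ℚ) (K := K) h2
  obtain ⟨q, hq, hd⟩ := NumberField.exists_discr_eq_mul_sq h2 hθ hc
  obtain ⟨C₁, hC₁⟩ := W.exists_variableChange_quadraticTwist_mul_sq c q hq
  rw [← hd] at hC₁
  obtain ⟨Cd, hCd⟩ := hWd
  obtain ⟨C', hC'⟩ := hW'
  subst hCd hC'
  have hc0 : c ≠ 0 := by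
    rintro rfl
    apply Quadratic.ne_zero_of_not_mem_range hθ
    have : θ ^ 2 = 0 := by rw [hc, map_zero]
    exact pow_eq_zero_iff (n := 2) (by norm_num) |>.mp this
  haveI : (W.quadraticTwist c).IsElliptic := W.isElliptic_quadraticTwist hc0
  haveI : (W.baseChange K).IsElliptic := by rw [baseChange]; infer_instance
  -- finiteness of `Ш(W^{(c)}/ℚ)[p^∞]` from that of the model `Wd = Cd • C₁ • W^{(c)}`
  haveI : Finite (AddCommGroup.primaryComponent (W.quadraticTwist c).sha p) := by
    have h1 : Nat.card (AddCommGroup.primaryComponent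
        (Cd • W.quadraticTwist (NumberField.discr K : ℚ)).sha p) =
          Nat.card (AddCommGroup.primaryComponent (W.quadraticTwist c).sha p) := by
      rw [card_primaryComponent_sha_variableChange, ← hC₁, card_primaryComponent_sha_variableChange]
    have hpos : 0 < Nat.card (AddCommGroup.primaryComponent (W.quadraticTwist c).sha p) := by
      rw [← h1]; exact Nat.card_pos
    exact (Nat.card_pos_iff.mp hpos).2
  -- the three index formulas and the comparison isomorphism
  have hK := (W.baseChange K).card_primaryComponent_sha_eq_relIndex p
  have hQ := W.card_primaryComponent_sha_eq_relIndex p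
  have hT := (W.quadraticTwist c).card_primaryComponent_sha_eq_relIndex p
  have hodd : Odd p := (Fact.out : p.Prime).odd_of_ne_two hp
  have hbij := comparisonMap_bijective_of_odd W K h2 hθ hc p hodd
  have hmap := map_comparisonMap_prod_ker_eq W K h2 hθ hc p hp
  have hidx : ((W.baseChange K).primaryH1ToH1 p).ker.relIndex (selmerGroupPInfty (W.baseChange K) p) =
      (W.primaryH1ToH1 p).ker.relIndex (selmerGroupPInfty W p) *
        ((W.quadraticTwist c).primaryH1ToH1 p).ker.relIndex
          (selmerGroupPInfty (W.quadraticTwist c) p) := by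
    rw [AddSubgroup.relIndex, AddSubgroup.relIndex, AddSubgroup.relIndex, ← hmap,
      AddSubgroup.index_map_of_bijective hbij, AddSubgroup.index_prod]
  -- transport to the models
  rw [card_primaryComponent_sha_variableChange, card_primaryComponent_sha_variableChange, ← hC₁,
    card_primaryComponent_sha_variableChange, hK, hidx, ← hQ, ← hT]

end WeierstrassCurve

end
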